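import Summits.HodgeConjecture.HodgeConjecture.Theorems.Ring2AbelianAllAndreCorrespondenceCategory
import Literature.AlgebraicGeometry.HodgeTheory.LefschetzStandardOfHodgeConjectureSquare
import Literature.AlgebraicGeometry.HodgeTheory.ComplexGysinCorrespondence
import Literature.AlgebraicGeometry.HodgeTheory.ComplexGysinHodgeType
import Literature.AlgebraicGeometry.HodgeTheory.ComplexOrientationCycleClassFacts
import Literature.AlgebraicGeometry.HodgeTheory.MotivatedClassesAlgebraic
import Literature.AlgebraicGeometry.HodgeTheory.HodgeTypeExteriorProduct
import Literature.AlgebraicGeometry.HodgeTheory.ComplexConjugation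
import Literature.AlgebraicGeometry.HodgeTheory.GysinKernelProofs
import Literature.NumberTheory.Transcendental.DeRhamTheoremMultiplicative
import HarnessLib

/-!
# Rational Hodge shifts between Betti groups and the Künneth slots of the square of a threefold
# (cell `hodge-nonav`, sector SQ3 — per-codimension package, composition, pull-back / Gysin, and the ODD slots
# `W₁₃(X)` from the fourfolds `X × C`, `C × X`)

PROVENANCE. Cell hodge-nonav (HUMAN RULING D-0038), planner seat p1: frozen sketches `HOME/p1/route/Sketch_P1T_SQ3_g21.lean`
(sha16 17f9dc68211263eb, §2 and §7) and `HOME/memos/ROUTE-P1U-Sketch.lean` (sha16 a80c611254891848, §3), both farm rc 0 / 0 sorries,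
re-elaborated 2026-08-28; landed by the prover seat `hodge-nonav-20241-p1` (g10) on the planner's assignment T2 (p1 g35, STATUS
2026-08-28T05:21:56Z) with `--supports stmt-HodgeConjecture-19654 --as helper`. DEF-FREE rendering: the sketches' Prop-valued
abbreviations (`IsRationalHodgeShift`, `OddShiftAlgebraic`, `WeightOneCurveRetractions`, `HC22TimesCurve`) are written as file-local
NOTATION expanding to their bodies; `HC22C[X]` is, symbol for symbol, the body of the tree's `ThreefoldTimesCurve.HC22TimesCurve X`
(file `Theorems/ThreefoldTimesCurveHodge`, which is not imported here only to keep this file out of the `SecondaryPeriods` route cone —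
a consumer holding `h : HC22TimesCurve X` passes `h` unchanged). Proof bodies verbatim.

CONTENT (sorry-free over tree theorems; no definition, no named fact):

* `RHShift[m, n, Y, X, a, b, e, φ]` — "`φ : Hᵃ(X) → Hᵇ(Y)` is (the complexification of) a morphism of RATIONAL Hodge structures of
  bidegree `(e − n, e − n)`" in the tree's model-free clauses (those of `isAlgebraicCorrespondence_of_hodgeConjectureFor_prod`):
  rational ↦ rational; type `(p,q)` ↦ type `(p+e−n, q+e−n)`; types without target ↦ `0`.
* §1 `isAlgebraicCorrespondence_of_shift_of_hodgeClasses_prod_algebraic` — **per-codimension package** (Voisin I Lemma 11.41 with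
  `HC(Y × X)` replaced by the algebraicity of the rational `(e,e)`-classes of `Y × X` only); `rhShift_comp` — composition of shifts.
* §2 `rhShift_map`, `rhShift_complexGysin` — pull-backs and (complex-orientation) Gysin maps are rational Hodge shifts.
* §3 the ODD Künneth slots of `HC22sq(X)`: `isAlgebraicCorrespondence_of_curve_retraction` / `_of_curve_section` (the mechanism) and
  `oddShifts_algebraic_of_hc22TimesCurve` — **the slots `(1,3)`, `(3,1)` (every rational Hodge morphism `H⁵(X) → H³(X)`,
  `H³(X) → H¹(X)` of bidegree `(−1,−1)` is an algebraic self-correspondence) follow from HC for `(2,2)`-classes on the FOURFOLDS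
  `X × C`, `C × X` (`HC22C[X]` = `HC22TimesCurve X`) plus the classical weight-one curve retractions `W1Retr[X]`** (typed input, PRINT:
  Albanese curve + Poincaré reducibility + Lefschetz `(1,1)`; not proved here).

HONEST SCOPE. Reductions and structure lemmas; nothing here proves the Hodge conjecture for a new variety; rung F-H1 not moved.

## References

* [VoisinHodgeI2002] C. Voisin, Hodge Theory and Complex Algebraic Geometry I (2002), §7.3.2, §11.3.3 Lemma 11.41, §12.1.3.
* [Voisin2025] C. Voisin (2025), §3.2.2 (15)–(16) and Lemma 2.9.
* [Kleiman1968AlgebraicCycles] S. Kleiman, Algebraic cycles and the Weil conjectures (1968), §2 (2A11).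
* [Andre1996Motifs] Y. André, Pour une théorie inconditionnelle des motifs, Publ. IHÉS 83 (1996), §2.1.
-/

set_option linter.dupNamespace false

noncomputable section

open CategoryTheory AlgebraicGeometry MonoidalCategory CartesianMonoidalCategory
open Literature.AlgebraicTopology.SingularHomology
open Literature.AlgebraicGeometry Literature.AlgebraicGeometry.Motives Literature.AlgebraicGeometry.HodgeTheory
open Summit.HodgeConjecture.HodgeConjecture.Theorems
open Summit.HodgeConjecture.HodgeConjecture.Ring2.AbelianAll

namespace Summit.HodgeConjecture.HodgeConjecture.Theorems.ThreefoldSquare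

/-- `RHShift[m, n, Y, X, a, b, e, φ]`: the `ℂ`-linear `φ : Hᵃ(X) → Hᵇ(Y)` (`dim X = n`, `dim Y = m`, `a + 2e = b + 2n`) is the
complexification of a morphism of RATIONAL Hodge structures of bidegree `(e − n, e − n)` — rational to rational; type `(p,q)` to
type `(p+e−n, q+e−n)`; types without target to `0` (verbatim the sketches' `IsRationalHodgeShift`). Local notation only. -/
local notation3 (prettyPrint := false) "RHShift[" m ", " n ", " Y ", " X ", " a ", " b ", " e ", " φ "]" =>
  ((∀ c, IsRationalClass c → IsRationalClass (φ c)) ∧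
  (∀ (p q : ℕ), p + q = a → ∀ c, IsOfHodgeType n X a p q c →
      ∀ (p' q' : ℕ), p' + n = p + e → q' + n = q + e → IsOfHodgeType m Y b p' q' (φ c)) ∧
  (∀ (p q : ℕ), p + q = a → ∀ c, IsOfHodgeType n X a p q c → (p + e < n ∨ q + e < n) → φ c = 0))

/-- `OddShifts[X]`: the Künneth slots `(1,3)` and `(3,1)` of `HC22sq(X)` — every rational Hodge morphism `H⁵(X) → H³(X)` resp.
`H³(X) → H¹(X)` of bidegree `(−1,−1)` is induced by an algebraic class on `X × X` (verbatim the sketches' `OddShiftAlgebraic`).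
Local notation only. -/
local notation3 (prettyPrint := false) "OddShifts[" X "]" =>
  ((∀ φ : complexBetti X 5 →ₗ[ℂ] complexBetti X 3,
    RHShift[3, 3, X, X, 5, 3, 2, φ] → IsAlgebraicCorrespondence 3 3 X X φ) ∧
  (∀ φ : complexBetti X 3 →ₗ[ℂ] complexBetti X 1,
    RHShift[3, 3, X, X, 3, 1, 2, φ] → IsAlgebraicCorrespondence 3 3 X X φ))

/-- `W1Retr[X]`: the classical weight-one curve retractions (verbatim the sketches' `WeightOneCurveRetractions`): `H¹(X)` is a
direct summand of `H¹` of a smooth projective curve through correspondences of the right kind — an algebraic `u : H⁵(X) → H¹(C)` with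
a rational-Hodge retraction `v`, and an algebraic `v' : H¹(C) → H¹(X)` with a rational-Hodge section `u'`. Local notation only. -/
local notation3 (prettyPrint := false) "W1Retr[" X "]" =>
  (∃ (C : SchemeOver ℂ) (_ : IsSmoothProjective 1 C)
    (u : complexBetti X 5 →ₗ[ℂ] complexBetti C 1) (v : complexBetti C 1 →ₗ[ℂ] complexBetti X 5)
    (u' : complexBetti X 1 →ₗ[ℂ] complexBetti C 1) (v' : complexBetti C 1 →ₗ[ℂ] complexBetti X 1),
    IsAlgebraicCorrespondence 1 3 C X u ∧ RHShift[3, 1, X, C, 1, 5, 3, v] ∧ v ∘ₗ u = LinearMap.id ∧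
    IsAlgebraicCorrespondence 3 1 X C v' ∧ RHShift[1, 3, C, X, 1, 1, 3, u'] ∧ v' ∘ₗ u' = LinearMap.id)

/-- `HC22C[X]`: the rational `(2,2)`-classes of `X × C` and of `C × X` are algebraic for every smooth projective curve `C` —
symbol for symbol the body of the tree's `ThreefoldTimesCurve.HC22TimesCurve X` (a FOURFOLD statement). Local notation only. -/
local notation3 (prettyPrint := false) "HC22C[" X "]" =>
  (∀ ⦃C : SchemeOver ℂ⦄, IsSmoothProjective 1 C →
    (∀ c : complexBetti (X ⊗ C) (2 * 2), IsRationalClass c →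
        IsOfHodgeType (3 + 1) (X ⊗ C) (2 * 2) 2 2 c → c ∈ algebraicClasses (X ⊗ C) 2) ∧
      (∀ c : complexBetti (C ⊗ X) (2 * 2), IsRationalClass c →
        IsOfHodgeType (1 + 3) (C ⊗ X) (2 * 2) 2 2 c → c ∈ algebraicClasses (C ⊗ X) 2))

variable {l m n : ℕ} {X Y Z C : SchemeOver ℂ}

/-! ## §1 The per-codimension package and composition of shifts -/

/-- **Per-codimension package** (the proof of the tree's `isAlgebraicCorrespondence_of_hodgeConjectureFor_prod` with `HC(Y × X)`
replaced by the algebraicity of the rational `(e,e)`-classes of `Y × X` only): a rational Hodge shift `φ : Hᵃ(X) → Hᵇ(Y)` of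
codimension `e` is the action of a rational `(e,e)`-class on `Y × X` (Voisin I Lemma 11.41, tree
`exists_hodgeClass_corrAction_eq_smul_of_shift`), hence an algebraic correspondence as soon as those classes are algebraic.
[cite: VoisinHodgeI2002, §11.3.3 Lemma 11.41] [cite: Voisin2025, §3.2.2 (15)–(16) and Lemma 2.9] -/
theorem isAlgebraicCorrespondence_of_shift_of_hodgeClasses_prod_algebraic
    (hY : IsSmoothProjective m Y) (hX : IsSmoothProjective n X) {a b e q : ℕ}
    (hab : a + 2 * e = b + 2 * n) (hq : b + q = 2 * m)
    (halg : ∀ c : complexBetti (Y ⊗ X) (2 * e), IsRationalClass c →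
      IsOfHodgeType (m + n) (Y ⊗ X) (2 * e) e e c → c ∈ algebraicClasses (Y ⊗ X) e)
    (φ : complexBetti X a →ₗ[ℂ] complexBetti Y b) (hφ : RHShift[m, n, Y, X, a, b, e, φ]) :
    IsAlgebraicCorrespondence m n Y X φ := by
  have hI := hodgePQ_independent_of_hodgeModel_holds
  obtain ⟨A⟩ := nonempty_hodgeModel_holds (n := m) (X := Y) hY
  obtain ⟨B⟩ := nonempty_hodgeModel_holds (n := n) (X := X) hX
  let μ : OrientationFamily := fun _ _ h ↦ Classical.choice (Motives.ComplexPoints.isOrientableOver ℂ h)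
  obtain ⟨hφr, hφH, hφ0⟩ := hφ
  obtain ⟨γ, hγr, hγH, t, ht, hact⟩ := exists_hodgeClass_corrAction_eq_smul_of_shift hY hX A B hab φ
    hφr
    (fun p q hpq c hc p' q' hp' hq' ↦ (hI.isOfHodgeType_iff hY A).1 (hφH p q hpq c ⟨B, hc⟩ p' q' hp' hq'))
    (fun p q hpq c hc hlt ↦ hφ0 p q hpq c ⟨B, hc⟩ hlt) μ
  have hφγ : φ = corrAction μ hY hX hab (t⁻¹ • γ) := by
    rw [map_smul, hact, smul_smul, inv_mul_cancel₀ ht, one_smul]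
  rw [hφγ]
  exact isAlgebraicCorrespondence_corrAction μ (OrientationFamily.hasPoincareDuality μ) hY hX hab hq
    (Submodule.smul_mem _ _ (halg γ hγr hγH))

/-- **Composition of rational Hodge shifts** (`ψ : H^{a₀}(Z) → Hᵃ(Y)` of codimension `e₁`, then `φ : Hᵃ(Y) → Hᵇ(X)` of codimension
`e₂`; composite codimension `E = e₁ + e₂ − dim Y`). [cite: VoisinHodgeI2002, §7.3.2 and §11.3.3] -/
theorem rhShift_comp (hX : IsSmoothProjective l X) {a₀ a b e₁ e₂ E : ℕ}
    {ψ : complexBetti Z a₀ →ₗ[ℂ] complexBetti Y a} {φ : complexBetti Y a →ₗ[ℂ] complexBetti X b}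
    (hψ : RHShift[m, n, Y, Z, a₀, a, e₁, ψ]) (hφ : RHShift[l, m, X, Y, a, b, e₂, φ])
    (hab : a₀ + 2 * e₁ = a + 2 * n) (hE : E + m = e₁ + e₂) :
    RHShift[l, n, X, Z, a₀, b, E, (φ ∘ₗ ψ)] := by
  obtain ⟨A⟩ := nonempty_hodgeModel_holds (n := l) (X := X) hX
  obtain ⟨hψr, hψH, hψ0⟩ := hψ
  obtain ⟨hφr, hφH, hφ0⟩ := hφ
  refine ⟨fun c hc ↦ hφr _ (hψr c hc), fun p q hpq c hc p' q' hp' hq' ↦ ?_, fun p q hpq c hc hlt ↦ ?_⟩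
  · by_cases hcase : n ≤ p + e₁ ∧ n ≤ q + e₁
    · obtain ⟨p₁, hp₁⟩ : ∃ p₁, p₁ + n = p + e₁ := ⟨p + e₁ - n, by omega⟩
      obtain ⟨q₁, hq₁⟩ : ∃ q₁, q₁ + n = q + e₁ := ⟨q + e₁ - n, by omega⟩
      have h₁ := hψH p q hpq c hc p₁ q₁ hp₁ hq₁
      exact hφH p₁ q₁ (by omega) (ψ c) h₁ p' q' (by omega) (by omega)
    · have h0 : ψ c = 0 := hψ0 p q hpq c hc (by omega)
      rw [LinearMap.comp_apply, h0, map_zero]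
      exact IsOfHodgeType.zero A b p' q'
  · by_cases hcase : n ≤ p + e₁ ∧ n ≤ q + e₁
    · obtain ⟨p₁, hp₁⟩ : ∃ p₁, p₁ + n = p + e₁ := ⟨p + e₁ - n, by omega⟩
      obtain ⟨q₁, hq₁⟩ : ∃ q₁, q₁ + n = q + e₁ := ⟨q + e₁ - n, by omega⟩
      have h₁ := hψH p q hpq c hc p₁ q₁ hp₁ hq₁
      exact hφ0 p₁ q₁ (by omega) (ψ c) h₁ (by omega)
    · have h0 : ψ c = 0 := hψ0 p q hpq c hc (by omega)
      rw [LinearMap.comp_apply, h0, map_zero]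

/-! ## §2 Pull-backs and Gysin maps are rational Hodge shifts -/

/-- **`f^* : Hᵃ(X) → Hᵃ(Y)` is a rational Hodge shift of codimension `n = dim X` (bidegree `(0,0)`).** [cite: VoisinHodgeI2002, §7.3.2] -/
theorem rhShift_map (hY : IsSmoothProjective m Y) (hX : IsSmoothProjective n X) (f : Y ⟶ X) (a : ℕ) :
    RHShift[m, n, Y, X, a, a, n, (complexBetti.map f a).hom] := by
  refine ⟨fun c hc ↦ hc.map _, fun p q hpq c hc p' q' hp' hq' ↦ ?_, fun p q hpq c hc hlt ↦ by omega⟩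
  obtain rfl : p' = p := by omega
  obtain rfl : q' = q := by omega
  exact hc.map_of_isSmoothProjective hY hX f

/-- **`f_* : Hᵃ(Y) → Hᵇ(X)` (`a + 2 dim X = b + 2 dim Y`, `dim Y ≤ dim X`) is a rational Hodge shift of codimension `dim X`
(bidegree `(dim X − dim Y, dim X − dim Y)`)**, for the complex orientations. [cite: VoisinHodgeI2002, §7.3.2 (with Lemma 7.30)] -/
theorem rhShift_complexGysin (hY : IsSmoothProjective m Y) (hX : IsSmoothProjective n X) (f : Y ⟶ X) {a b : ℕ}
    (hab : a + 2 * n = b + 2 * m) (hmn : m ≤ n) :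
    RHShift[n, m, X, Y, a, b, n, complexGysin complexOrientationFamily hY hX f hab] := by
  refine ⟨fun c hc ↦ isRationalClass_complexGysin_complexOrientationFamily hY hX f hab hc,
    fun p q hpq c hc p' q' hp' hq' ↦ ?_, fun p q hpq c hc hlt ↦ by omega⟩
  exact isOfHodgeType_complexGysin hodgePQ_independent_of_hodgeModel_holds
    (fun _ _ ↦ nonempty_hodgeModel_holds)
    (fun E _ _ _ ↦ Literature.NumberTheory.Transcendental.exists_deRhamIsoFamily_holds E)
    complexOrientationFamily hY hX f hab (by omega) (by omega) hc

/-! ## §3 The odd Künneth slots descend to the fourfolds `X × C`, `C × X` -/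

/-- **THE MECHANISM: curve retractions.** If `u : H⁵(X) → H¹(C)` is an algebraic correspondence with a linear retraction
`v : H¹(C) → H⁵(X)`, `v ∘ u = id`, then a linear `φ : H⁵(X) → H³(X)` is an algebraic self-correspondence of `X` as soon as
`φ ∘ v : H¹(C) → H³(X)` is an algebraic correspondence from `C` to `X` — a codimension-2 class on the FOURFOLD `X × C`.
[cite: Andre1996Motifs, §2.1 (p. 15)] -/
theorem isAlgebraicCorrespondence_of_curve_retraction (hX : IsSmoothProjective 3 X)
    (hC : IsSmoothProjective 1 C) {u : complexBetti X 5 →ₗ[ℂ] complexBetti C 1}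
    {v : complexBetti C 1 →ₗ[ℂ] complexBetti X 5} (hu : IsAlgebraicCorrespondence 1 3 C X u)
    (hvu : v ∘ₗ u = LinearMap.id) (φ : complexBetti X 5 →ₗ[ℂ] complexBetti X 3)
    (h : IsAlgebraicCorrespondence 3 1 X C (φ ∘ₗ v)) : IsAlgebraicCorrespondence 3 3 X X φ := by
  have hφ : φ = (φ ∘ₗ v) ∘ₗ u := by rw [LinearMap.comp_assoc, hvu, LinearMap.comp_id]
  rw [hφ]
  exact IsAlgebraicCorrespondence.comp hX hC hX hu h (by norm_num)

/-- Transposed mechanism for `φ : H³(X) → H¹(X)`: a section `u' : H¹(X) → H¹(C)` of an algebraic `v' : H¹(C) → H¹(X)`.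
[cite: Andre1996Motifs, §2.1 (p. 15)] -/
theorem isAlgebraicCorrespondence_of_curve_section (hX : IsSmoothProjective 3 X)
    (hC : IsSmoothProjective 1 C) {u' : complexBetti X 1 →ₗ[ℂ] complexBetti C 1}
    {v' : complexBetti C 1 →ₗ[ℂ] complexBetti X 1} (hv' : IsAlgebraicCorrespondence 3 1 X C v')
    (hvu : v' ∘ₗ u' = LinearMap.id) (φ : complexBetti X 3 →ₗ[ℂ] complexBetti X 1)
    (h : IsAlgebraicCorrespondence 1 3 C X (u' ∘ₗ φ)) : IsAlgebraicCorrespondence 3 3 X X φ := by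
  have hφ : φ = v' ∘ₗ (u' ∘ₗ φ) := by rw [← LinearMap.comp_assoc, hvu, LinearMap.id_comp]
  rw [hφ]
  exact IsAlgebraicCorrespondence.comp hX hC hX h hv' (by norm_num)

/-- **RUNG SQ3-W (KERNEL given its two typed inputs): the odd Künneth slots of `HC22sq(X)` follow from HC for `(2,2)`-classes on
the FOURFOLDS `X × C`, `C × X` (`HC22C[X]`, i.e. `ThreefoldTimesCurve.HC22TimesCurve X`) plus the classical weight-one
curve retractions `W1Retr[X]`.** (statement: cell hodge-nonav ROUTE-P1T row SQ3-W; method after [cite: VoisinHodgeI2002, §11.3.3 Lemma 11.41 and §12.1.3 Thm. 12.15])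
[cite: Kleiman1968AlgebraicCycles, §2 2A11] -/
theorem oddShifts_algebraic_of_hc22TimesCurve (hX : IsSmoothProjective 3 X)
    (hR : W1Retr[X]) (h : HC22C[X]) : OddShifts[X] := by
  obtain ⟨C, hC, u, v, u', v', hu, hv, hvu, hv', hu', hvu'⟩ := hR
  obtain ⟨hXC, hCX⟩ := h hC
  refine ⟨fun φ hφ ↦ ?_, fun φ hφ ↦ ?_⟩
  · refine isAlgebraicCorrespondence_of_curve_retraction hX hC hu hvu φ ?_
    exact isAlgebraicCorrespondence_of_shift_of_hodgeClasses_prod_algebraic hX hC (a := 1) (b := 3) (e := 2)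
      (q := 3) (by norm_num) (by norm_num) hXC (φ ∘ₗ v)
      (rhShift_comp hX hv hφ (by norm_num) (by norm_num))
  · refine isAlgebraicCorrespondence_of_curve_section hX hC hv' hvu' φ ?_
    exact isAlgebraicCorrespondence_of_shift_of_hodgeClasses_prod_algebraic hC hX (a := 3) (b := 1) (e := 2)
      (q := 1) (by norm_num) (by norm_num) hCX (u' ∘ₗ φ)
      (rhShift_comp hC hφ hu' (by norm_num) (by norm_num))

end Summit.HodgeConjecture.HodgeConjecture.Theorems.ThreefoldSquare

end
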